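import Literature.NumberTheory.EllipticCurves.HeegnerTraceRelationLevelDividingProofs
import Literature.NumberTheory.EllipticCurves.HeegnerNormPointExistenceAnyConductorProofs
import HarnessLib

/-!
# The `U_p`-relation of Heegner norm points in `E(K̄)` at a prime `p ∣ N`, and the trace of the
# canonical Heegner family along the anticyclotomic tower: `Tr_{K_{j+1}/K_j} z_{j+1} = a_p · z_j`
# (`= 0` when `a_p = 0`, e.g. at an additive prime)

Topic `NumberTheory/EllipticCurves` (complex multiplication / Heegner points; sequel of
`HeegnerTraceRelationLevelDividingProofs` (the relation in `E(ℂ)`), `HeegnerGeomGaloisTransferProofs` /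
`HeegnerGeomTransversalProofs` (the dictionary `E(K̄)` ↔ `E(K[c]) ⊂ E(ℂ)`, transversal sums) and
`HeegnerNormPointExistenceAnyConductorProofs` (the CANONICAL Heegner family of `p`-power conductor at any
prime, `exists_heegnerFamily_canonical`)). THEOREMS ONLY: no definition, no named fact (D-0026); net
Literature debt `0`.

## Statements

Let `E = W/ℚ` with a parametrisation datum `Dt` at level `N`, `K` imaginary quadratic, `β` an orientation
(`4N ∣ β² − d_K`), `jbar : K̄ → ℂ`, `p` a prime DIVIDING `N`, and `x₁, x₂ ∈ E(K̄)` the canonical Heegner points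
of conductors `p^{e+1}`, `p^{e+2}` (`complexPoint x_i = y(p^{e+i}) = φ(x(p^{e+i}))`, `x₂` read over
`K[p^{e+2}]`).

* `sum_transversal_smul_eq_lFunction_smul_of_dvd_level` — for ANY finite transversal `R` of
  `Gal(K̄/K[p^{e+2}])` in `Gal(K̄/K[p^{e+1}])`: `∑_{r ∈ R} r • x₂ = a_p(W) • x₁` (`a_p(W) = W.LFunction p`) —
  the tree's `HeegnerTraceLevelDividing.finsum_mem_ringClassGalOver_eq_lFunction_smul_of_dvd_level` read in
  `E(K̄)` through `exists_finset_ringClassGalOver_complexPoint_sum_smul_eq` and the injectivity of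
  `complexPoint`; `…_sum_of_le` — the same over any `Λ ≥ Gal(K̄/K[p^{e+1}])`
  (`∑_{r ∈ R} r • x₂ = a_p • ∑_{a ∈ A} a • x₁`, product decomposition of transversals).
* `sum_range_pow_smul_z_succ_eq_lFunction_smul_z` — for a Heegner family `F` along a `ℤ_p`-extension `κ`
  (topological generator `γ`) whose norm points `z_j`, `z_{j+1}` are built from the canonical points of
  conductors `p^{j+1}`, `p^{j+2}` (the shape produced by `exists_heegnerFamily_canonical`), UNDER THE TOWER
  BINDER `K_j ⊆ K[p^{j+1}]`, `K_{j+1} ⊆ K[p^{j+2}]` (`ringClassSubgroup K (p^{k+1}) jbar ≤ κ.layerSubgroup k`,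
  the tree's standing anticyclotomic-tower hypothesis, Howard 2004 §3.3 / Perrin-Riou 1987 §3.2 / CGLS 2022
  proof of Thm. 4.1.1 with `d(k) ≤ k + 1`; class field theory, not proved here):
  **`∑_{i<p} γ^{p^j i} • z_{j+1} = a_p(W) • z_j`**, i.e. `Tr_{K_{j+1}/K_j} z_{j+1} = a_p z_j`; hence
  `= 0` when `a_p(W) = 0` (`…_eq_zero_of_lFunction_eq_zero`).
* `exists_heegnerFamily_trace_eq_lFunction_smul` / `exists_heegnerFamily_trace_eq_zero` /
  `exists_heegnerFamily_traceTorsion_of_lFunction_eq_zero` — packaged with `exists_heegnerFamily_canonical`: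
  for `p ∣ N` and the tower binder there IS a family `F` with `F.Dt = Dt`, `F.β = β` and
  `Tr_{K_{j+1}/K_j} z_{j+1} = a_p • z_j` for EVERY `j`; when `a_p(W) = 0` the traces VANISH, in particular
  `∃ m ≠ 0, m • Tr = 0` with `m = 1` for every `j ≥ 0` — VERBATIM the hypothesis `hTT` of the Heegner-module
  barrier lemmas `…TraceZeroHeegnerModuleTorsion.heegnerModule_eq_bot_of_(eventually_)traceTorsion` and
  clause (i) of the named fact `CornutVatsal2007.exists_heegnerFamily_traceTorsion_of_sq_dvd`
  (Cornut–Vatsal 2007, Lemma 4.9 (iii) / Lemma 6.14, there for `p² ∣ N` and `n ≫ 0`), here PROVED for every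
  `p ∣ N` with `a_p = 0` and every `j`, modulo the tower binder. (Clause (ii) of that fact, Mazur / Cornut–Vatsal
  NON-triviality, Thm. 1.10, is untouched: it is the deep half.)

HONEST FRAMING: classical CM theory (Shimura reciprocity on `X₀(N)`, Eichler–Shimura `U_p f = a_p f`) plus
group theory; the containment `K_j ⊆ K[p^{j+1}]` is a HYPOTHESIS; nothing on `L`-functions beyond the
coefficient `a_p`, nothing on Selmer groups or BSD is asserted.

## References

* [CornutVatsal2007] §4.3 Lemma 4.9 (iii), §6.4 Lemma 6.14 (held `book:burns2007-l-functions-galois-representations`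
  p0191, p0216).
* [Howard2004HeegnerKolyvagin] B. Howard, *The Heegner point Kolyvagin system*, Compos. Math. 140 (2004),
  §3.3 (`P_k[1] = Norm_{K[p^{k+1}]/K_k} P[p^{k+1}]`, `K_k ⊂ K[p^{k+1}]`).
* [PerrinRiou1987BSMF] §3.2–3.3 (relations de distribution le long de la tour anticyclotomique).
* [CastellaGrossiLeeSkinner2022] proof of Thm. 4.1.1 (`d(k)`), Rem. 4.1.4.
* [GrossLMS1991] §3; [Darmon2004] Prop. 3.10.
-/

set_option autoImplicit false

noncomputable section

open scoped Classical

namespace Literature.NumberTheory.EllipticCurves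

namespace HeegnerGeomLevelDividing

open _root_.WeierstrassCurve RingClassField Literature.NumberTheory.EllipticCurves.ModularForms
open Literature.NumberTheory.EllipticCurves.HeegnerTraceLevelDividing

variable {K : Type} [Field K] [NumberField K]

/-! ## §1 The `U_p`-relation in `E(K̄)` over transversals -/

/-- **`Tr_{K[p^{e+2}]/K[p^{e+1}]} P[p^{e+2}] = a_p · P[p^{e+1}]` IN `E(K̄)` at a prime `p ∣ N`, over ANY
transversal.** For `E = W/ℚ` with a parametrisation datum `Dt` at level `N`, `K` imaginary quadratic,
`4N ∣ β² − d_K`, a prime `p ∣ N`, points `x₁, x₂ ∈ E(K̄)` whose complex points along `jbar` are the canonical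
Heegner points of conductors `p^{e+1}`, `p^{e+2}` (`x₂` read over `K[p^{e+2}]` through `P₂`), and ANY finite
transversal `R` of `Gal(K̄/K[p^{e+2}])` in `Gal(K̄/K[p^{e+1}])` (the shape of `IsHeegnerNormPoint`):
`∑_{r ∈ R} r • x₂ = a_p(W) • x₁`, `a_p(W) = W.LFunction p`. The transversal sum is the Galois trace in
`E(K[p^{e+2}])` (`exists_finset_ringClassGalOver_complexPoint_sum_smul_eq`), which is
`HeegnerTraceLevelDividing.finsum_mem_ringClassGalOver_eq_lFunction_smul_of_dvd_level` (`U_p` on the conjugates);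
`complexPoint` is injective. [cite: CornutVatsal2007, §6.4 Lemma 6.14 and §4.3 Lemma 4.9 (iii)]
[cite: PerrinRiou1987BSMF, §3.3 (relations de distribution)] -/
theorem sum_transversal_smul_eq_lFunction_smul_of_dvd_level {N : ℕ} [NeZero N] {W : WeierstrassCurve ℚ}
    [W.IsElliptic] (hK : IsImaginaryQuadratic K) (Dt : ModularParametrizationData W N) {β : ℤ}
    (hβ : (4 * N : ℤ) ∣ β ^ 2 - NumberField.discr K) (jbar : AlgebraicClosure K →+* ℂ) {p : ℕ}
    (hp : p.Prime) (hpN : p ∣ N) (e : ℕ) {x₁ x₂ : WeierstrassCurve.geomPoints (W.baseChange K)}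
    (hx₁ : complexPoint W jbar x₁ = heegnerPointComplexOfConductor Dt (NumberField.discr K) β (p ^ (e + 1)))
    {P₂ : (W.baseChange (ringClassField K (jbar.comp (algebraMap K (AlgebraicClosure K))) (p ^ (e + 2)))).toAffine.Point}
    (hx₂ : complexPoint W jbar x₂ = WeierstrassCurve.Affine.Point.map (W' := W)
      (ringClassField K (jbar.comp (algebraMap K (AlgebraicClosure K))) (p ^ (e + 2))).subtype.toRatAlgHom P₂)
    (hP₂ : WeierstrassCurve.Affine.Point.map (W' := W)
      (ringClassField K (jbar.comp (algebraMap K (AlgebraicClosure K))) (p ^ (e + 2))).subtype.toRatAlgHom P₂ =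
      heegnerPointComplexOfConductor Dt (NumberField.discr K) β (p ^ (e + 2)))
    {R : Finset (Field.absoluteGaloisGroup K)} (hRsub : ∀ r ∈ R, r ∈ ringClassSubgroup K (p ^ (e + 1)) jbar)
    (htrans : ∀ τ ∈ ringClassSubgroup K (p ^ (e + 1)) jbar,
      ∃! r, r ∈ R ∧ r⁻¹ * τ ∈ ringClassSubgroup K (p ^ (e + 2)) jbar) :
    ∑ r ∈ R, r • x₂ = (W.LFunction p) • x₁ := by
  have hc : p ^ (e + 1) ≠ 0 := pow_ne_zero _ hp.ne_zero
  have hc' : p ^ (e + 2) ≠ 0 := pow_ne_zero _ hp.ne_zero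
  have hcc' : p ^ (e + 1) ∣ p ^ (e + 2) := pow_dvd_pow p (Nat.le_succ _)
  -- the transversal sum is the Galois trace in `E(K[p^{e+2}])`
  obtain ⟨G, hG, hsum⟩ := exists_finset_ringClassGalOver_complexPoint_sum_smul_eq W hK jbar hc hc' hcc'
    hx₂ hRsub htrans
  -- the `U_p`-relation for the principal points
  have hpm : p ∣ p ^ (e + 1) := dvd_pow_self p (Nat.succ_ne_zero e)
  have hn : p * p ^ (e + 1) = p ^ (e + 2) := by rw [← pow_succ']
  have key := finsum_mem_ringClassGalOver_eq_lFunction_smul_of_dvd_level hK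
    (jbar.comp (algebraMap K (AlgebraicClosure K))) Dt hβ hp hpN hpm hc hn hP₂
  -- rewrite the `∑ᶠ` over `Gal(K[p^{e+2}]/K[p^{e+1}])` as the sum over `G`
  have hGset : (ringClassGalOver (jbar.comp (algebraMap K (AlgebraicClosure K))) (p ^ (e + 2)) (p ^ (e + 1)) :
      Set (ringClassField K (jbar.comp (algebraMap K (AlgebraicClosure K))) (p ^ (e + 2)) ≃ₐ[ℚ]
        ringClassField K (jbar.comp (algebraMap K (AlgebraicClosure K))) (p ^ (e + 2)))) = ↑G := by
    ext g
    rw [SetLike.mem_coe, Finset.mem_coe, hG]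
  rw [hGset, finsum_mem_coe_finset, ← map_sum] at key
  -- compare complex points and conclude by injectivity
  apply complexPoint_injective W jbar
  rw [hsum, key, map_zsmul, hx₁]

/-- **`U_p`-descent of Heegner norms over a bigger group** (Howard 2004 §3.3 / Perrin-Riou 1987 §3.3, at a
prime `p ∣ N`): with the data of `sum_transversal_smul_eq_lFunction_smul_of_dvd_level`, for ANY subgroup
`Λ ≥ Gal(K̄/K[p^{e+1}])` (e.g. `Gal(K̄/K_k)` with `K_k ⊆ K[p^{e+1}]`), ANY finite transversal `A ⊆ Λ` of
`Gal(K̄/K[p^{e+1}])` in `Λ` and ANY finite transversal `R ⊆ Λ` of `Gal(K̄/K[p^{e+2}])` in `Λ`: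
`∑_{r ∈ R} r • x₂ = a_p(W) • ∑_{a ∈ A} a • x₁`. [cite: Howard2004HeegnerKolyvagin, §3.3 (norms of Heegner points along the towers)]
[cite: PerrinRiou1987BSMF, §3.3 (relations de distribution)] -/
theorem sum_transversal_smul_eq_lFunction_smul_sum_of_le {N : ℕ} [NeZero N] {W : WeierstrassCurve ℚ}
    [W.IsElliptic] (hK : IsImaginaryQuadratic K) (Dt : ModularParametrizationData W N) {β : ℤ}
    (hβ : (4 * N : ℤ) ∣ β ^ 2 - NumberField.discr K) (jbar : AlgebraicClosure K →+* ℂ) {p : ℕ}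
    (hp : p.Prime) (hpN : p ∣ N) (e : ℕ) {x₁ x₂ : WeierstrassCurve.geomPoints (W.baseChange K)}
    (hx₁ : complexPoint W jbar x₁ = heegnerPointComplexOfConductor Dt (NumberField.discr K) β (p ^ (e + 1)))
    {P₂ : (W.baseChange (ringClassField K (jbar.comp (algebraMap K (AlgebraicClosure K))) (p ^ (e + 2)))).toAffine.Point}
    (hx₂ : complexPoint W jbar x₂ = WeierstrassCurve.Affine.Point.map (W' := W)
      (ringClassField K (jbar.comp (algebraMap K (AlgebraicClosure K))) (p ^ (e + 2))).subtype.toRatAlgHom P₂)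
    (hP₂ : WeierstrassCurve.Affine.Point.map (W' := W)
      (ringClassField K (jbar.comp (algebraMap K (AlgebraicClosure K))) (p ^ (e + 2))).subtype.toRatAlgHom P₂ =
      heegnerPointComplexOfConductor Dt (NumberField.discr K) β (p ^ (e + 2)))
    (hx₂fix : ∀ σ ∈ ringClassSubgroup K (p ^ (e + 2)) jbar, σ • x₂ = x₂)
    {Λ : Subgroup (Field.absoluteGaloisGroup K)} (hΛ : ringClassSubgroup K (p ^ (e + 1)) jbar ≤ Λ)
    {A : Finset (Field.absoluteGaloisGroup K)} (hA : ∀ a ∈ A, a ∈ Λ)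
    (htA : ∀ τ ∈ Λ, ∃! a, a ∈ A ∧ a⁻¹ * τ ∈ ringClassSubgroup K (p ^ (e + 1)) jbar)
    {R : Finset (Field.absoluteGaloisGroup K)} (hR : ∀ r ∈ R, r ∈ Λ)
    (htR : ∀ τ ∈ Λ, ∃! r, r ∈ R ∧ r⁻¹ * τ ∈ ringClassSubgroup K (p ^ (e + 2)) jbar) :
    ∑ r ∈ R, r • x₂ = (W.LFunction p) • ∑ a ∈ A, a • x₁ := by
  have hc' : p ^ (e + 2) ≠ 0 := pow_ne_zero _ hp.ne_zero
  have hle : ringClassSubgroup K (p ^ (e + 2)) jbar ≤ ringClassSubgroup K (p ^ (e + 1)) jbar :=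
    ringClassSubgroup_anti hK jbar (pow_dvd_pow p (Nat.le_succ _)) hc'
  haveI : (ringClassSubgroup K (p ^ (e + 2)) jbar).FiniteIndex := finiteIndex_ringClassSubgroup K (p ^ (e + 2)) jbar
  obtain ⟨S, hS, htS⟩ := exists_finset_transversal' (ringClassSubgroup K (p ^ (e + 2)) jbar)
    (ringClassSubgroup K (p ^ (e + 1)) jbar)
  rw [sum_smul_eq_sum_sum_smul hle hΛ hA htA hS htS hR htR hx₂fix,
    sum_transversal_smul_eq_lFunction_smul_of_dvd_level hK Dt hβ jbar hp hpN e hx₁ hx₂ hP₂ hS htS,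
    Finset.smul_sum]
  refine Finset.sum_congr rfl fun a _ ↦ ?_
  rw [smul_comm]

/-! ## §2 The `γ`-power transversal of consecutive anticyclotomic layers -/

section Layers

variable {p : ℕ} [Fact p.Prime]

omit [NumberField K] in
/-- **`{γ^{p^k i}}_{i<p}` is a transversal of `Gal(K̄/K_{k+1})` in `Gal(K̄/K_k)`** for a topological generator
`γ` of the `ℤ_p`-extension `κ` (`Gal(K_{k+1}/K_k) = ⟨γ^{p^k}⟩ ≅ ℤ/p`); copy of
`transversal_pow_layerSubgroup_succ` (`HeegnerGeomStabilizedPointIdentitiesProofs`), kept local to spare the import.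
[cite: Washington1997, §13.1 (Gal(K_{n+1}/K_n) ≅ ℤ/pℤ generated by γ^{p^n})] -/
theorem transversal_pow_layerSubgroup_succ' (κ : ZpExtension K p)
    {γ : Field.absoluteGaloisGroup K} (hγ : κ.IsTopGenerator γ) (k : ℕ) :
    (∀ g ∈ (Finset.range p).image (fun i : ℕ ↦ γ ^ (p ^ k * i)), g ∈ κ.layerSubgroup k) ∧
      ∀ τ ∈ κ.layerSubgroup k, ∃! g, g ∈ (Finset.range p).image (fun i : ℕ ↦ γ ^ (p ^ k * i)) ∧
        g⁻¹ * τ ∈ κ.layerSubgroup (k + 1) := by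
  have hp : p.Prime := Fact.out
  have hγ' : κ γ = Multiplicative.ofAdd 1 := hγ
  have hκγ : ∀ m : ℕ, (κ (γ ^ m)).toAdd = (m : ℤ_[p]) := fun m ↦ by
    rw [map_pow, hγ', ← ofAdd_nsmul, toAdd_ofAdd, nsmul_eq_mul, mul_one]
  have hmem : ∀ i : ℕ, γ ^ (p ^ k * i) ∈ κ.layerSubgroup k := fun i ↦ by
    rw [ZpExtension.mem_layerSubgroup, hκγ, Nat.cast_mul, Nat.cast_pow]
    exact Dvd.intro _ rfl
  refine ⟨fun g hg ↦ ?_, fun τ hτ ↦ ?_⟩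
  · obtain ⟨i, -, rfl⟩ := Finset.mem_image.mp hg
    exact hmem i
  rw [ZpExtension.mem_layerSubgroup] at hτ
  obtain ⟨c, hc⟩ := hτ
  have hval : ∀ j : ℕ, (κ ((γ ^ (p ^ k * j))⁻¹ * τ)).toAdd = (p : ℤ_[p]) ^ k * (c - (j : ℤ_[p])) := by
    intro j
    rw [map_mul, map_inv, toAdd_mul, toAdd_inv, hκγ, hc, Nat.cast_mul, Nat.cast_pow]
    ring
  have hcrit : ∀ j : ℕ, (γ ^ (p ^ k * j))⁻¹ * τ ∈ κ.layerSubgroup (k + 1) ↔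
      c - (j : ℤ_[p]) ∈ Ideal.span {(p : ℤ_[p]) ^ 1} := by
    intro j
    rw [ZpExtension.mem_layerSubgroup, hval, pow_one, Ideal.mem_span_singleton, pow_succ]
    exact mul_dvd_mul_iff_left (pow_ne_zero _ (Nat.cast_ne_zero.mpr hp.ne_zero))
  set i₀ : ℕ := c.appr 1 with hi₀
  have hi₀p : i₀ < p := by simpa using PadicInt.appr_lt c 1
  have hi₀mem : c - (i₀ : ℤ_[p]) ∈ Ideal.span {(p : ℤ_[p]) ^ 1} := PadicInt.appr_spec 1 c
  refine ⟨γ ^ (p ^ k * i₀), ⟨Finset.mem_image.mpr ⟨i₀, Finset.mem_range.mpr hi₀p, rfl⟩,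
    (hcrit i₀).mpr hi₀mem⟩, fun g hg ↦ ?_⟩
  obtain ⟨hgim, hgτ⟩ := hg
  obtain ⟨j, hj, rfl⟩ := Finset.mem_image.mp hgim
  have hjmem := (hcrit j).mp hgτ
  have hzmod := PadicInt.zmod_congr_of_sub_mem_span 1 c j i₀ hjmem hi₀mem
  rw [pow_one, ZMod.natCast_eq_natCast_iff', Nat.mod_eq_of_lt (Finset.mem_range.mp hj),
    Nat.mod_eq_of_lt hi₀p] at hzmod
  rw [hzmod]

omit [NumberField K] in
/-- `i ↦ γ^{p^k i}` is injective on `{0, …, p−1}` (`κ(γ^{p^k i}) = p^k i` in the domain `ℤ_p`); copy of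
`topGenerator_pow_injOn` (`HeegnerGeomCoherentPointIdentitiesProofs`), kept local to spare the import.
[cite: Washington1997, §13.1 (Gal(K_{n+1}/K_n) ≅ ℤ/p generated by γ^{p^n})] -/
theorem topGenerator_pow_injOn' (κ : ZpExtension K p) {γ : Field.absoluteGaloisGroup K}
    (hγ : κ.IsTopGenerator γ) (k : ℕ) :
    Set.InjOn (fun i : ℕ ↦ γ ^ (p ^ k * i)) ↑(Finset.range p) := by
  have hp : p.Prime := Fact.out
  have hγ' : κ γ = Multiplicative.ofAdd 1 := hγ
  intro i _ j _ h
  have h' := congrArg (fun g ↦ (κ g).toAdd) h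
  simp only [map_pow, hγ', ← ofAdd_nsmul, toAdd_ofAdd, nsmul_eq_mul, mul_one, Nat.cast_mul,
    Nat.cast_pow] at h'
  exact_mod_cast mul_left_cancel₀ (pow_ne_zero k (Nat.cast_ne_zero.mpr hp.ne_zero)) h'

end Layers

/-! ## §3 The trace of the canonical family along the anticyclotomic tower at `p ∣ N` -/

section Family

variable {p : ℕ} [Fact p.Prime] {N : ℕ} [NeZero N] {W : WeierstrassCurve ℚ} [W.IsElliptic]
  {κ : ZpExtension K p} {jbar : AlgebraicClosure K →+* ℂ}

/-- **`Tr_{K_{j+1}/K_j} z_{j+1} = a_p(W) · z_j` for the canonical Heegner family at a prime `p ∣ N`, under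
the tower binder.** Let `F` be a Heegner family (level `N`, orientation `F.β`, datum `F.Dt`) along the
`ℤ_p`-extension `κ` with topological generator `γ`, whose norm points at the layers `j` and `j + 1` are
`z_j = ∑_{a ∈ R₁} a • x₁`, `z_{j+1} = ∑_{r ∈ R} r • x₂` for the CANONICAL points `x₁, x₂ ∈ E(K̄)` of
conductors `p^{j+1}`, `p^{j+2}` (`complexPoint x_i = y(p^{j+i})`, fixed by `Gal(K̄/K[p^{j+i}])`) and
transversals `R₁ ⊆ Gal(K̄/K_j)`, `R ⊆ Gal(K̄/K_{j+1})` (the data of `exists_heegnerFamily_canonical`). Assume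
the tower containments `K_j ⊆ K[p^{j+1}]`, `K_{j+1} ⊆ K[p^{j+2}]`
(`ringClassSubgroup K (p^{k+1}) jbar ≤ κ.layerSubgroup k`, Howard 2004 §3.3; class field theory, a HYPOTHESIS
here). Then `∑_{i<p} γ^{p^j i} • z_{j+1} = a_p(W) • z_j`. Proof: `{γ^{p^j i}} · R` and `R₁ · V` (`V` a
transversal of `Gal(K̄/K[p^{j+2}])` in `Gal(K̄/K[p^{j+1}])`) are both transversals of `Gal(K̄/K[p^{j+2}])` in
`Gal(K̄/K_j)` (`sum_smul_eq_sum_sum_smul`, twice), and `∑_{v ∈ V} v • x₂ = a_p • x₁` (§1).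
[cite: Howard2004HeegnerKolyvagin, §3.3 (P_k[1] = Norm_{K[p^{k+1}]/K_k} P[p^{k+1}])]
[cite: CornutVatsal2007, §4.3 Lemma 4.9 (iii) and §6.4 Lemma 6.14] [cite: PerrinRiou1987BSMF, §3.3] -/
theorem sum_range_pow_smul_z_succ_eq_lFunction_smul_z (hK : IsImaginaryQuadratic K)
    {γ : Field.absoluteGaloisGroup K} (hγ : κ.IsTopGenerator γ) (hpN : p ∣ N)
    (F : HeegnerFamily N W K κ jbar) (j : ℕ)
    (hTw₁ : ringClassSubgroup K (p ^ (j + 1)) jbar ≤ κ.layerSubgroup j)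
    (hTw₂ : ringClassSubgroup K (p ^ (j + 2)) jbar ≤ κ.layerSubgroup (j + 1))
    {x₁ : WeierstrassCurve.geomPoints (W.baseChange K)} {R₁ : Finset (Field.absoluteGaloisGroup K)}
    (hx₁ : complexPoint W jbar x₁ = heegnerPointComplexOfConductor F.Dt (NumberField.discr K) F.β (p ^ (j + 1)))
    (hR₁sub : ↑R₁ ⊆ (κ.layerSubgroup j : Set (Field.absoluteGaloisGroup K)))
    (htrans₁ : ∀ τ ∈ κ.layerSubgroup j, ∃! r, r ∈ R₁ ∧ r⁻¹ * τ ∈ ringClassSubgroup K (p ^ (j + 1)) jbar)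
    (hz₁ : F.z j = ∑ r ∈ R₁, r • x₁)
    {x₂ : WeierstrassCurve.geomPoints (W.baseChange K)} {R : Finset (Field.absoluteGaloisGroup K)}
    (hx₂ : complexPoint W jbar x₂ = heegnerPointComplexOfConductor F.Dt (NumberField.discr K) F.β (p ^ (j + 2)))
    (hfix₂ : ∀ σ ∈ ringClassSubgroup K (p ^ (j + 2)) jbar, σ • x₂ = x₂)
    (hRsub : ↑R ⊆ (κ.layerSubgroup (j + 1) : Set (Field.absoluteGaloisGroup K)))
    (htrans : ∀ τ ∈ κ.layerSubgroup (j + 1), ∃! r, r ∈ R ∧ r⁻¹ * τ ∈ ringClassSubgroup K (p ^ (j + 2)) jbar)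
    (hz : F.z (j + 1) = ∑ r ∈ R, r • x₂) :
    ∑ i ∈ Finset.range p, (γ ^ (p ^ j * i)) • F.z (j + 1) = (W.LFunction p) • F.z j := by
  have hp : p.Prime := Fact.out
  set ι : K →+* ℂ := jbar.comp (algebraMap K (AlgebraicClosure K)) with hι
  have hc' : p ^ (j + 2) ≠ 0 := pow_ne_zero _ hp.ne_zero
  -- `x₂` read over `K[p^{j+2}]`
  obtain ⟨P₂, hP₂⟩ := phi_heegnerPointOfConductor_mem_range_map_ringClassField_of_ne_zero N W K hK F.Dt F.β ι
    (p ^ (j + 2)) F.dvd_sq_sub hc'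
  have hx₂P : complexPoint W jbar x₂ = WeierstrassCurve.Affine.Point.map (W' := W)
      (ringClassField K ι (p ^ (j + 2))).subtype.toRatAlgHom P₂ := hx₂.trans hP₂.symm
  rw [hz, hz₁]
  -- the `γ`-power trace as a transversal sum over `{γ^{p^j i}}`
  rw [← Finset.sum_image (f := fun g ↦ g • ∑ r ∈ R, r • x₂) (topGenerator_pow_injOn' κ hγ j)]
  obtain ⟨hG, htG⟩ := transversal_pow_layerSubgroup_succ' κ hγ j
  -- ONE transversal `R'` of `Gal(K̄/K[p^{j+2}])` in `Gal(K̄/K_j)`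
  haveI : (ringClassSubgroup K (p ^ (j + 2)) jbar).FiniteIndex := finiteIndex_ringClassSubgroup K (p ^ (j + 2)) jbar
  obtain ⟨R', hR', htR'⟩ := exists_finset_transversal' (ringClassSubgroup K (p ^ (j + 2)) jbar) (κ.layerSubgroup j)
  have hle₂ : ringClassSubgroup K (p ^ (j + 2)) jbar ≤ κ.layerSubgroup j :=
    hTw₂.trans (κ.layerSubgroup_antitone (Nat.le_succ j))
  -- (1) decompose `R'` through `Gal(K̄/K_{j+1})`
  rw [← sum_smul_eq_sum_sum_smul hTw₂ (κ.layerSubgroup_antitone (Nat.le_succ j)) hG htG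
    (fun r hr ↦ hRsub (Finset.mem_coe.mpr hr)) htrans hR' htR' hfix₂]
  -- (2) decompose `R'` through `Gal(K̄/K[p^{j+1}])` and apply the `U_p`-relation
  exact sum_transversal_smul_eq_lFunction_smul_sum_of_le hK F.Dt F.dvd_sq_sub jbar hp hpN j hx₁ hx₂P hP₂
    hfix₂ hTw₁ (fun a ha ↦ hR₁sub (Finset.mem_coe.mpr ha)) htrans₁ hR' htR'

/-- **`Tr_{K_{j+1}/K_j} z_{j+1} = 0` when `a_p(W) = 0`** (e.g. `p` of additive reduction, `p² ∣ N_E`: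
`WeierstrassCurve.LFunction_apply_eq_zero_of_hasAdditiveReductionAt`), for the canonical family at `p ∣ N`
under the tower binder; data as in `sum_range_pow_smul_z_succ_eq_lFunction_smul_z`.
[cite: CornutVatsal2007, §4.3 Lemma 4.9 (iii) and §6.4 Lemma 6.14] -/
theorem sum_range_pow_smul_z_succ_eq_zero_of_lFunction_eq_zero (hK : IsImaginaryQuadratic K)
    {γ : Field.absoluteGaloisGroup K} (hγ : κ.IsTopGenerator γ) (hpN : p ∣ N) (hap : W.LFunction p = 0)
    (F : HeegnerFamily N W K κ jbar) (j : ℕ)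
    (hTw₁ : ringClassSubgroup K (p ^ (j + 1)) jbar ≤ κ.layerSubgroup j)
    (hTw₂ : ringClassSubgroup K (p ^ (j + 2)) jbar ≤ κ.layerSubgroup (j + 1))
    {x₁ : WeierstrassCurve.geomPoints (W.baseChange K)} {R₁ : Finset (Field.absoluteGaloisGroup K)}
    (hx₁ : complexPoint W jbar x₁ = heegnerPointComplexOfConductor F.Dt (NumberField.discr K) F.β (p ^ (j + 1)))
    (hR₁sub : ↑R₁ ⊆ (κ.layerSubgroup j : Set (Field.absoluteGaloisGroup K)))
    (htrans₁ : ∀ τ ∈ κ.layerSubgroup j, ∃! r, r ∈ R₁ ∧ r⁻¹ * τ ∈ ringClassSubgroup K (p ^ (j + 1)) jbar)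
    (hz₁ : F.z j = ∑ r ∈ R₁, r • x₁)
    {x₂ : WeierstrassCurve.geomPoints (W.baseChange K)} {R : Finset (Field.absoluteGaloisGroup K)}
    (hx₂ : complexPoint W jbar x₂ = heegnerPointComplexOfConductor F.Dt (NumberField.discr K) F.β (p ^ (j + 2)))
    (hfix₂ : ∀ σ ∈ ringClassSubgroup K (p ^ (j + 2)) jbar, σ • x₂ = x₂)
    (hRsub : ↑R ⊆ (κ.layerSubgroup (j + 1) : Set (Field.absoluteGaloisGroup K)))
    (htrans : ∀ τ ∈ κ.layerSubgroup (j + 1), ∃! r, r ∈ R ∧ r⁻¹ * τ ∈ ringClassSubgroup K (p ^ (j + 2)) jbar)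
    (hz : F.z (j + 1) = ∑ r ∈ R, r • x₂) :
    ∑ i ∈ Finset.range p, (γ ^ (p ^ j * i)) • F.z (j + 1) = 0 := by
  rw [sum_range_pow_smul_z_succ_eq_lFunction_smul_z hK hγ hpN F j hTw₁ hTw₂ hx₁ hR₁sub htrans₁ hz₁ hx₂
    hfix₂ hRsub htrans hz, hap, zero_zsmul]

/-- **The canonical family at `p ∣ N`: `Tr_{K_{j+1}/K_j} z_{j+1} = a_p(W) • z_j` for EVERY `j`**, packaged.
For `E = W/ℚ` with a datum `Dt` at level `N`, `K` imaginary quadratic, orientation `β`, embedding `jbar`, a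
`ℤ_p`-extension `κ` with topological generator `γ` satisfying the tower binder `K_k ⊆ K[p^{k+1}]` for all `k`,
and a prime `p ∣ N`: there IS a Heegner family `F` (`exists_heegnerFamily_canonical`: canonical points of
conductor `p^{k+1}`) with `F.Dt = Dt`, `F.β = β` and `∑_{i<p} γ^{p^j i} • z_{j+1} = a_p(W) • z_j` for all `j`.
[cite: Howard2004HeegnerKolyvagin, §3.3] [cite: CornutVatsal2007, §4.3 Lemma 4.9 (iii) and §6.4 Lemma 6.14] -/
theorem exists_heegnerFamily_trace_eq_lFunction_smul (hK : IsImaginaryQuadratic K) (κ : ZpExtension K p)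
    {γ : Field.absoluteGaloisGroup K} (hγ : κ.IsTopGenerator γ) (Dt : ModularParametrizationData W N)
    {β : ℤ} (hβ : (4 * N : ℤ) ∣ β ^ 2 - NumberField.discr K) (jbar : AlgebraicClosure K →+* ℂ)
    (hpN : p ∣ N) (hTw : ∀ k : ℕ, ringClassSubgroup K (p ^ (k + 1)) jbar ≤ κ.layerSubgroup k) :
    ∃ F : HeegnerFamily N W K κ jbar, F.Dt = Dt ∧ F.β = β ∧
      ∀ j : ℕ, ∑ i ∈ Finset.range p, (γ ^ (p ^ j * i)) • F.z (j + 1) = (W.LFunction p) • F.z j := by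
  obtain ⟨F, hFDt, hFβ, -, hcan⟩ := exists_heegnerFamily_canonical hK κ Dt hβ jbar
  refine ⟨F, hFDt, hFβ, fun j ↦ ?_⟩
  obtain ⟨x₁, R₁, hx₁, -, hR₁sub, htrans₁, hz₁⟩ := hcan j
  obtain ⟨x₂, R, hx₂, hfix₂, hRsub, htrans, hz⟩ := hcan (j + 1)
  subst hFDt hFβ
  exact sum_range_pow_smul_z_succ_eq_lFunction_smul_z hK hγ hpN F j (hTw j) (hTw (j + 1)) hx₁ hR₁sub htrans₁
    hz₁ hx₂ hfix₂ hRsub htrans hz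

/-- **The canonical family at a prime `p ∣ N` with `a_p(W) = 0` has VANISHING traces `Tr_{K_{j+1}/K_j} z_{j+1}`
for every `j`** (additive `p`: `p² ∣ N_E`, `a_p = 0`), under the tower binder.
[cite: CornutVatsal2007, §4.3 Lemma 4.9 (iii) and §6.4 Lemma 6.14] -/
theorem exists_heegnerFamily_trace_eq_zero (hK : IsImaginaryQuadratic K) (κ : ZpExtension K p)
    {γ : Field.absoluteGaloisGroup K} (hγ : κ.IsTopGenerator γ) (Dt : ModularParametrizationData W N)
    {β : ℤ} (hβ : (4 * N : ℤ) ∣ β ^ 2 - NumberField.discr K) (jbar : AlgebraicClosure K →+* ℂ)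
    (hpN : p ∣ N) (hap : W.LFunction p = 0)
    (hTw : ∀ k : ℕ, ringClassSubgroup K (p ^ (k + 1)) jbar ≤ κ.layerSubgroup k) :
    ∃ F : HeegnerFamily N W K κ jbar, F.Dt = Dt ∧ F.β = β ∧
      ∀ j : ℕ, ∑ i ∈ Finset.range p, (γ ^ (p ^ j * i)) • F.z (j + 1) = 0 := by
  obtain ⟨F, hFDt, hFβ, htr⟩ := exists_heegnerFamily_trace_eq_lFunction_smul hK κ hγ Dt hβ jbar hpN hTw
  exact ⟨F, hFDt, hFβ, fun j ↦ by rw [htr j, hap, zero_zsmul]⟩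

/-- **Clause (i) of `CornutVatsal2007.exists_heegnerFamily_traceTorsion_of_sq_dvd` in its own currency, PROVED
modulo the tower binder**, for every prime `p ∣ N` with `a_p(W) = 0` and EVERY `j ≥ 0` (`j₀ = 0`, `m = 1`):
there is a Heegner family `F` with `F.Dt = Dt`, `F.β = β` and
`∀ j, ∃ m : ℤ, m ≠ 0 ∧ m • (∑_{i<p} γ^{p^j i} • F.z (j+1)) = 0` — VERBATIM the hypothesis `hTT` of the tree's
Heegner-module barrier lemmas (`…TraceZeroHeegnerModuleTorsion.heegnerModule_eq_bot_of_traceTorsion`).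
[cite: CornutVatsal2007, §4.3 Lemma 4.9 (iii) and §6.4 Lemma 6.14] -/
theorem exists_heegnerFamily_traceTorsion_of_lFunction_eq_zero (hK : IsImaginaryQuadratic K)
    (κ : ZpExtension K p) {γ : Field.absoluteGaloisGroup K} (hγ : κ.IsTopGenerator γ)
    (Dt : ModularParametrizationData W N) {β : ℤ} (hβ : (4 * N : ℤ) ∣ β ^ 2 - NumberField.discr K)
    (jbar : AlgebraicClosure K →+* ℂ) (hpN : p ∣ N) (hap : W.LFunction p = 0)
    (hTw : ∀ k : ℕ, ringClassSubgroup K (p ^ (k + 1)) jbar ≤ κ.layerSubgroup k) :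
    ∃ F : HeegnerFamily N W K κ jbar, F.Dt = Dt ∧ F.β = β ∧
      ∀ j : ℕ, ∃ m : ℤ, m ≠ 0 ∧ m • (∑ i ∈ Finset.range p, (γ ^ (p ^ j * i)) • F.z (j + 1)) = 0 := by
  obtain ⟨F, hFDt, hFβ, htr⟩ := exists_heegnerFamily_trace_eq_zero hK κ hγ Dt hβ jbar hpN hap hTw
  exact ⟨F, hFDt, hFβ, fun j ↦ ⟨1, one_ne_zero, by rw [htr j, smul_zero]⟩⟩

end Family

end HeegnerGeomLevelDividing

end Literature.NumberTheory.EllipticCurves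

end
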